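import Summits.Ventures.HSemireg.ObstructionLocusCrossingDoubleCokernel

/-!
# Venture HSemireg — (S5) OBSTRUCTION LOCUS away from secant type, XXXVIII: generic tools for EXT-NOTE §6.B(c) in a
# MIDDLE degree — the two ends of a long exact `Ext` sequence around one term, the covariant cokernel under
# injectivity, and kernels ∕ cokernels of scalar matrices along entrywise equivalences and finite products

HONEST FRAMING.  Part of the Lean side of the computation cell `pub-hsemireg` (track «S4-PUSH» (ii), seat
s4-prove-2).  GENERIC homological ∕ linear algebra in `ModuleCat A` over a commutative ring `A`, on top of file XXXI
(`extPrecomp`, `extConnecting`, `extPostcomp`, `extPostcompG`, `scalarMatrix`) and Mathlib's derived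
`CategoryTheory.Abelian.Ext` with its long exact sequences (`Ext.contravariant_sequence_exact₁₂₃`,
`Ext.covariant_sequence_exact₃`).  Nothing here is specific to block models; nothing here says that HC / HC_CM / HC_AV
holds; no Literature fact is declared or used.

CONTENT.  For a short exact `0 → X₁ →f X₂ →g X₃ → 0` in `ModuleCat A`, a module `N` and a degree `k`:
* `extPrecompG` (`g^*`), `range_extConnecting_eq_ker_extPrecompG` (exactness at `Ext^{k+1}(X₃, N)`),
  `range_extPrecompG_eq_ker_extPrecomp` (exactness at `Ext^k(X₂, N)`);
* **`rangeExtConnectingEquiv`**: `Ext^k(X₁, N) ⧸ range f^* ≃ₗ[A] range ∂` — the SUB-piece `range ∂ ⊆ Ext^{k+1}(X₃, N)`;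
* **`quotRangeExtConnectingEquiv`**: `Ext^{k+1}(X₃, N) ⧸ range ∂ ≃ₗ[A] ker (f^* on Ext^{k+1}(X₂, N))` — the QUOTIENT piece;
* covariantly, `extConnecting'` (`δ`), and **`extCokernelEquivOfInjective'`**: `Ext^k(X, X₂) ⧸ range f_* ≃ₗ[A] Ext^k(X, X₃)`
  as soon as `f_*` is INJECTIVE on `Ext^{k+1}(X, X₁)` (file XXXI's `extCokernelEquiv'` assumed `Ext^{k+1}(X, X₁) = 0`);
* scalar matrices: `map_ker_scalarMatrix` ∕ `kerScalarMatrixCongr` (kernels along an entrywise equivalence),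
  `piSwap₂`, `kerScalarMatrixPiEquiv` and `quotRangeScalarMatrixPiEquiv` (kernels and cokernels on product-valued vectors
  are the products).
References (dictionary only): EXT-NOTE.md §6.B(c).
-/

open CategoryTheory CategoryTheory.Abelian
open scoped BigOperators

universe u

namespace Summit.Ventures.HSemireg.ObstructionLocus

/-! ## Around one term of the contravariant long exact sequence -/

section Contra

variable {A : Type u} [CommRing A] {S : ShortComplex (ModuleCat.{u} A)} (hS : S.ShortExact)
  (N : ModuleCat.{u} A) (k : ℕ)

/-- `g^* : Ext^k(X₃, N) →ₗ[A] Ext^k(X₂, N)`, precomposition with `[g] ∈ Ext⁰(X₂, X₃)`. -/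
noncomputable def extPrecompG : Ext.{u} S.X₃ N k →ₗ[A] Ext.{u} S.X₂ N k :=
  Ext.bilinearCompOfLinear A S.X₂ S.X₃ N 0 k k (zero_add k) (Ext.mk₀ S.g)

/-- The formula for `g^*`. -/
theorem extPrecompG_apply (x : Ext.{u} S.X₃ N k) :
    extPrecompG (S := S) N k x = (Ext.mk₀ S.g).comp x (zero_add k) := rfl

/-- `f^* ∘ g^* = 0`. -/
theorem extPrecomp_extPrecompG (x : Ext.{u} S.X₃ N k) :
    extPrecomp N k (extPrecompG N k x) = 0 := by
  rw [extPrecompG_apply, extPrecomp_apply, ← Ext.comp_assoc_of_second_deg_zero, Ext.mk₀_comp_mk₀, S.zero,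
    Ext.mk₀_zero, Ext.zero_comp]

/-- `g^* ∘ ∂ = 0`. -/
theorem extPrecompG_extConnecting (η : Ext.{u} S.X₁ N k) :
    extPrecompG N (k + 1) (extConnecting hS N k η) = 0 := by
  rw [extPrecompG_apply, extConnecting_apply, hS.comp_extClass_assoc]

/-- **Exactness at `Ext^{k+1}(X₃, N)`**: `range ∂ = ker g^*`. -/
theorem range_extConnecting_eq_ker_extPrecompG :
    LinearMap.range (extConnecting hS N k) = LinearMap.ker (extPrecompG (S := S) N (k + 1)) := by
  apply le_antisymm
  · rintro _ ⟨η, rfl⟩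
    exact extPrecompG_extConnecting hS N k η
  · intro x hx
    rw [LinearMap.mem_ker, extPrecompG_apply] at hx
    obtain ⟨η, hη⟩ := Ext.contravariant_sequence_exact₃ hS N x hx (Nat.add_comm 1 k)
    exact ⟨η, hη⟩

include hS in
/-- **Exactness at `Ext^k(X₂, N)`**: `range g^* = ker f^*`. -/
theorem range_extPrecompG_eq_ker_extPrecomp :
    LinearMap.range (extPrecompG (S := S) N k) = LinearMap.ker (extPrecomp (S := S) N k) := by
  apply le_antisymm
  · rintro _ ⟨x, rfl⟩
    exact extPrecomp_extPrecompG N k x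
  · intro x hx
    rw [LinearMap.mem_ker, extPrecomp_apply] at hx
    obtain ⟨y, hy⟩ := Ext.contravariant_sequence_exact₂ hS N x hx
    exact ⟨y, hy⟩

/-- **The sub-piece**: `Ext^k(X₁, N) ⧸ range f^* ≃ₗ[A] range ∂` (`∂ : Ext^k(X₁, N) → Ext^{k+1}(X₃, N)`), induced by `∂`. -/
noncomputable def rangeExtConnectingEquiv :
    (Ext.{u} S.X₁ N k ⧸ LinearMap.range (extPrecomp (S := S) N k)) ≃ₗ[A]
      ↥(LinearMap.range (extConnecting hS N k)) :=
  (Submodule.quotEquivOfEq _ _ (range_extPrecomp_eq_ker_extConnecting hS N k)).trans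
    (LinearMap.quotKerEquivRange _)

/-- **The quotient piece**: `Ext^{k+1}(X₃, N) ⧸ range ∂ ≃ₗ[A] ker (f^* : Ext^{k+1}(X₂, N) → Ext^{k+1}(X₁, N))`,
induced by `g^*`. -/
noncomputable def quotRangeExtConnectingEquiv :
    (Ext.{u} S.X₃ N (k + 1) ⧸ LinearMap.range (extConnecting hS N k)) ≃ₗ[A]
      ↥(LinearMap.ker (extPrecomp (S := S) N (k + 1))) :=
  (Submodule.quotEquivOfEq _ _ (range_extConnecting_eq_ker_extPrecompG hS N k)).trans
    ((LinearMap.quotKerEquivRange _).trans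
      (LinearEquiv.ofEq _ _ (range_extPrecompG_eq_ker_extPrecomp hS N (k + 1))))

/-- The value of the quotient-piece map on a class: `g^*`. -/
theorem quotRangeExtConnectingEquiv_mk (x : Ext.{u} S.X₃ N (k + 1)) :
    (quotRangeExtConnectingEquiv hS N k (Submodule.Quotient.mk x) : Ext.{u} S.X₂ N (k + 1)) =
      extPrecompG N (k + 1) x := rfl

end Contra

/-! ## The covariant cokernel under injectivity of `f_*` in the next degree -/

section Co

variable {A : Type u} [CommRing A] {S : ShortComplex (ModuleCat.{u} A)} (hS : S.ShortExact)
  (X : ModuleCat.{u} A) (k : ℕ)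

/-- `δ : Ext^k(X, X₃) →ₗ[A] Ext^{k+1}(X, X₁)`, the Yoneda product with the class of the extension on the right. -/
noncomputable def extConnecting' : Ext.{u} X S.X₃ k →ₗ[A] Ext.{u} X S.X₁ (k + 1) :=
  (Ext.bilinearCompOfLinear A X S.X₃ S.X₁ k 1 (k + 1) rfl).flip hS.extClass

/-- The formula for `δ`. -/
theorem extConnecting'_apply (x : Ext.{u} X S.X₃ k) :
    extConnecting' hS X k x = x.comp hS.extClass rfl := rfl

/-- `f_* ∘ δ = 0`. -/
theorem extPostcomp_extConnecting' (x : Ext.{u} X S.X₃ k) :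
    extPostcomp X (k + 1) (extConnecting' hS X k x) = 0 := by
  rw [extPostcomp_apply, extConnecting'_apply, Ext.comp_assoc_of_third_deg_zero, hS.extClass_comp, Ext.comp_zero]

include hS in
/-- **`g_*` is onto `Ext^k(X, X₃)` as soon as `f_*` is injective on `Ext^{k+1}(X, X₁)`** (then `δ = 0`). -/
theorem extPostcompG_surjective_of_injective (hinj : Function.Injective (extPostcomp (S := S) X (k + 1))) :
    Function.Surjective (extPostcompG (S := S) X k) := by
  intro x₃
  have h0 : extConnecting' hS X k x₃ = 0 :=
    hinj (by rw [extPostcomp_extConnecting', map_zero])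
  rw [extConnecting'_apply] at h0
  obtain ⟨η, hη⟩ := Ext.covariant_sequence_exact₃ X hS x₃ rfl h0
  exact ⟨η, hη⟩

/-- **`Ext^k(X, X₂) ⧸ range f_* ≃ₗ[A] Ext^k(X, X₃)`** when `f_*` is injective on `Ext^{k+1}(X, X₁)`, induced by `g_*`
(file XXXI's `extCokernelEquiv'` is the case `Ext^{k+1}(X, X₁) = 0`). -/
noncomputable def extCokernelEquivOfInjective' (hinj : Function.Injective (extPostcomp (S := S) X (k + 1))) :
    (Ext.{u} X S.X₂ k ⧸ LinearMap.range (extPostcomp (S := S) X k)) ≃ₗ[A] Ext.{u} X S.X₃ k :=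
  (Submodule.quotEquivOfEq _ _ (range_extPostcomp_eq_ker_extPostcompG hS X k)).trans
    (LinearMap.quotKerEquivOfSurjective _ (extPostcompG_surjective_of_injective hS X k hinj))

end Co

/-! ## Scalar matrices: kernels and cokernels along entrywise equivalences and finite products -/

section Matrices

variable {A : Type u} [CommRing A] {P P' : Type u} [AddCommGroup P] [Module A P] [AddCommGroup P'] [Module A P']
  {T₁ T₂ : Type} [Fintype T₁]

/-- Scalar matrices commute with entrywise linear equivalences: the kernels correspond. -/
theorem map_ker_scalarMatrix (c : T₂ → T₁ → A) (e : P ≃ₗ[A] P') :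
    (LinearMap.ker (scalarMatrix P c)).map
        ((LinearEquiv.piCongrRight fun _ : T₁ => e) : (T₁ → P) →ₗ[A] (T₁ → P')) =
      LinearMap.ker (scalarMatrix P' c) := by
  have key : ∀ w : T₁ → P,
      scalarMatrix P' c (fun a => e (w a)) = fun b => e (scalarMatrix P c w b) := by
    intro w
    funext b
    simp [scalarMatrix_apply, map_sum, map_smul]
  ext w'
  simp only [Submodule.mem_map, LinearMap.mem_ker]
  constructor
  · rintro ⟨w, hw, rfl⟩
    change scalarMatrix P' c (fun a => e (w a)) = 0
    rw [key, hw]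
    funext b
    exact map_zero e
  · intro hw'
    refine ⟨fun a => e.symm (w' a), ?_, ?_⟩
    · apply (LinearEquiv.piCongrRight fun _ : T₂ => e).injective
      change (fun b => e (scalarMatrix P c (fun a => e.symm (w' a)) b)) = _
      rw [← key, map_zero]
      simpa using hw'
    · funext a
      simp

/-- `ker (c on P-valued vectors) ≃ₗ[A] ker (c on P'-valued vectors)` along `e : P ≃ P'`. -/
noncomputable def kerScalarMatrixCongr (c : T₂ → T₁ → A) (e : P ≃ₗ[A] P') :
    ↥(LinearMap.ker (scalarMatrix P c)) ≃ₗ[A] ↥(LinearMap.ker (scalarMatrix P' c)) :=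
  (LinearEquiv.piCongrRight fun _ : T₁ => e).submoduleMap _ |>.trans (LinearEquiv.ofEq _ _ (map_ker_scalarMatrix c e))

variable {τ : Type} (Q : τ → Type u) [∀ t, AddCommGroup (Q t)] [∀ t, Module A (Q t)]

/-- `(Π_t Q_t)^{T} ≃ Π_t Q_t^{T}` (swap of indices). -/
def piSwap₂ (T : Type) : (T → (t : τ) → Q t) ≃ₗ[A] ((t : τ) → T → Q t) where
  toFun f t i := f i t
  invFun g i t := g t i
  map_add' _ _ := rfl
  map_smul' _ _ := rfl
  left_inv _ := rfl
  right_inv _ := rfl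

/-- Scalar matrices on product-valued vectors act componentwise (file XXXIII's `scalarMatrix_pi_apply`, swapped form). -/
theorem piSwap₂_scalarMatrix (c : T₂ → T₁ → A) (v : T₁ → (t : τ) → Q t) :
    piSwap₂ (A := A) Q T₂ (scalarMatrix ((t : τ) → Q t) c v) =
      fun t => scalarMatrix (Q t) c (piSwap₂ (A := A) Q T₁ v t) := by
  funext t b
  exact scalarMatrix_pi_apply Q c v b t

/-- **Kernels on product-valued vectors are products**: `ker (c on (Π_t Q_t)-vectors) ≃ₗ[A] Π_t ker (c on Q_t-vectors)`. -/
noncomputable def kerScalarMatrixPiEquiv (c : T₂ → T₁ → A) :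
    ↥(LinearMap.ker (scalarMatrix ((t : τ) → Q t) c)) ≃ₗ[A] ((t : τ) → ↥(LinearMap.ker (scalarMatrix (Q t) c))) where
  toFun w := fun t => ⟨piSwap₂ (A := A) Q T₁ w.1 t, by
    have h := congr_fun (piSwap₂_scalarMatrix Q c w.1) t
    rw [LinearMap.mem_ker, ← h, LinearMap.mem_ker.1 w.2, map_zero]
    rfl⟩
  invFun g := ⟨(piSwap₂ (A := A) Q T₁).symm fun t => (g t).1, by
    rw [LinearMap.mem_ker]
    apply (piSwap₂ (A := A) Q T₂).injective
    rw [piSwap₂_scalarMatrix, map_zero]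
    funext t
    rw [LinearEquiv.apply_symm_apply]
    exact LinearMap.mem_ker.1 (g t).2⟩
  map_add' _ _ := rfl
  map_smul' _ _ := rfl
  left_inv _ := rfl
  right_inv _ := rfl

/-- The range of a scalar matrix on product-valued vectors is the product of the ranges. -/
theorem map_range_scalarMatrix_piSwap₂ (c : T₂ → T₁ → A) :
    (LinearMap.range (scalarMatrix ((t : τ) → Q t) c)).map
        (piSwap₂ (A := A) Q T₂ : (T₂ → (t : τ) → Q t) →ₗ[A] ((t : τ) → T₂ → Q t)) =
      Submodule.pi Set.univ (fun t => LinearMap.range (scalarMatrix (Q t) c)) := by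
  apply le_antisymm
  · rintro _ ⟨_, ⟨v, rfl⟩, rfl⟩ t _
    rw [LinearEquiv.coe_coe, piSwap₂_scalarMatrix]
    exact ⟨_, rfl⟩
  · intro g hg
    have hg' : ∀ t, ∃ w : T₁ → Q t, scalarMatrix (Q t) c w = g t := fun t => hg t (Set.mem_univ t)
    choose w hw using hg'
    refine ⟨(piSwap₂ (A := A) Q T₂).symm g, ⟨(piSwap₂ (A := A) Q T₁).symm w, ?_⟩, LinearEquiv.apply_symm_apply _ _⟩
    apply (piSwap₂ (A := A) Q T₂).injective
    rw [piSwap₂_scalarMatrix, LinearEquiv.apply_symm_apply, LinearEquiv.apply_symm_apply]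
    funext t
    exact hw t

/-- **Cokernels on product-valued vectors are products**:
`(Π_t Q_t)^{T₂} ⧸ range c ≃ₗ[A] Π_t (Q_t^{T₂} ⧸ range c)`. -/
noncomputable def quotRangeScalarMatrixPiEquiv [Fintype τ] [DecidableEq τ] (c : T₂ → T₁ → A) :
    ((T₂ → (t : τ) → Q t) ⧸ LinearMap.range (scalarMatrix ((t : τ) → Q t) c)) ≃ₗ[A]
      ((t : τ) → (T₂ → Q t) ⧸ LinearMap.range (scalarMatrix (Q t) c)) :=
  (Submodule.Quotient.equiv _ _ (piSwap₂ (A := A) Q T₂) (map_range_scalarMatrix_piSwap₂ Q c)).trans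
    (Submodule.quotientPi _)

/-- **Kernels on vectors with values in a cokernel of product-valued vectors**, factor by factor:
`ker(c' on ((Π_t Q_t)^{T₂} ⧸ range c)-vectors) ≃ₗ[A] Π_t ker(c' on (Q_t^{T₂} ⧸ range c)-vectors)`. -/
noncomputable def kerScalarMatrixQuotPiEquiv [Fintype τ] [DecidableEq τ] {T₃ : Type} [Fintype T₂]
    (c : T₂ → T₁ → A) (c' : T₃ → T₂ → A) :
    ↥(LinearMap.ker (scalarMatrix ((T₂ → (t : τ) → Q t) ⧸ LinearMap.range (scalarMatrix ((t : τ) → Q t) c)) c'))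
      ≃ₗ[A] ((t : τ) → ↥(LinearMap.ker (scalarMatrix ((T₂ → Q t) ⧸ LinearMap.range (scalarMatrix (Q t) c)) c'))) :=
  (kerScalarMatrixCongr c' (quotRangeScalarMatrixPiEquiv Q c)).trans
    (kerScalarMatrixPiEquiv (fun t => (T₂ → Q t) ⧸ LinearMap.range (scalarMatrix (Q t) c)) c')

end Matrices

end Summit.Ventures.HSemireg.ObstructionLocus
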